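import Literature.Analysis.FluidPDE.TorusWordSobolev
import Literature.Analysis.FunctionSpaces.TorusSobolevSup
import Literature.Analysis.FunctionSpaces.TorusSobolevL4
import Mathlib.Analysis.MeanInequalities
import HarnessLib

/-!
# Lattice Sobolev norms of smooth real fields on the flat torus: the toolkit

Analysis/FluidPDE support file for the energy-method construction of Euler flows in the
periodic cylinder (`Literature.Analysis.FluidPDE.KatoLai1984_periodicCylinderUniformExistence`;
Kato–Lai 1984, §4 "Estimates for the Euler equation": "The following results are more or less
well known"). The evolution runs on the flat torus `T³` in Fourier variables; this file fixes the
**lattice Sobolev energies** of a smooth real field `u : T^d → ℝ^d`,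

  `latNormSq m u = ∑_k (1 + |k|²)^m ‖û(k)‖²`   (`û = mFourierCoeff (complexify ∘ u)`),

and collects the inequalities through which all product estimates of the sequel are routed:

* `summable_latWeight`, `latNormSq_nonneg`, `latNormSq_mono` (in `m`), `latNormSq_zero`
  (`= ∫ ‖u‖²`);
* `integral_norm_sq_wordDeriv_le_latNormSq` — `∫ ‖∂_w u‖² ≤ (4π²)^{|w|}… ≤ (4π²)^m latNormSq m u`
  (`TorusWordSobolev`), and `latNormSq_le_pure` — `latNormSq m u ≤ (#d+1)^m (∫‖u‖² + ∑ᵢ ∫‖∂ᵢᵐu‖²)`;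
* `latNormSq_wordDeriv_le` — **derivatives shift the level**:
  `latNormSq m (∂_w u) ≤ (4π²)^{|w|} latNormSq (m + |w|) u`;
* `latNormSq_interpolate` — **log-convexity in the level** (Hölder on the lattice):
  `latNormSq b u ≤ (latNormSq a u)^θ (latNormSq c u)^{1-θ}` for `b = θ a + (1-θ) c`;
* `norm_sq_le_latNormSq_two` — **`H² ⊂ L^∞` on `T³`**: `‖u(x)‖² ≤ K · latNormSq 2 u`
  (the tree's `Torus.norm_sq_le_sobolev_two_of_isSmooth`);
* `integral_norm_pow_four_le_latNormSq_one_sq` — **`H¹ ⊂ L⁴` on `T³`**: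
  `∫ ‖u‖⁴ ≤ K · (latNormSq 1 u)²` (the tree's `Torus.lintegral_enorm_pow_four_le_sq_of_isSmooth`).

Everything is proved; no named fact and no `sorry` is introduced. Constants are existential.

## Mathlib / tree search

Tree: `Torus.tsum_weight_mul_norm_sq_le`, `Torus.integral_norm_sq_wordDeriv_le`,
`Torus.hasSum_norm_sq_wordSymbol_mul`, `Torus.mFourierCoeff_complexify_wordDeriv`
(`TorusWordSobolev`); `Torus.norm_sq_le_sobolev_two_of_isSmooth` (`TorusSobolevSup`);
`Torus.lintegral_enorm_pow_four_le_sq_of_isSmooth` (`TorusSobolevL4`);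
`Torus.norm_fderiv_sq_le_card_mul_sum` (`LadyzhenskayaTorus`). Mathlib:
`Real.inner_le_Lp_mul_Lq_tsum_of_nonneg`, `Real.holderConjugate_one_div`.

## References

* T. Kato, C. Y. Lai, J. Funct. Anal. 56 (1984) 15–28, §4. [KatoLai1984]
* L. Grafakos, *Classical Fourier Analysis*, 3rd ed., Springer 2014, Prop. 3.2.7. [Grafakos2014]
-/

noncomputable section

open Filter Topology TopologicalSpace Finset MeasureTheory UnitAddTorus
open scoped ENNReal NNReal ComplexConjugate InnerProductSpace

namespace Literature.Analysis.FluidPDE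

namespace Torus

open FunctionSpaces FunctionSpaces.Torus

universe u

variable {d : Type u} [Fintype d] [DecidableEq d]

/-! ### The lattice energies -/

section Def

variable {u : UnitAddTorus d → EuclideanSpace ℝ d}

/-- **The lattice Sobolev energy** `∑_k (1 + |k|²)^m ‖û(k)‖²` of a real field. [folklore] -/
def latNormSq (m : ℕ) (u : UnitAddTorus d → EuclideanSpace ℝ d) : ℝ :=
  ∑' k : d → ℤ, (1 + freqNormSq k) ^ m * ‖mFourierCoeff (EuclideanSpace.complexify ∘ u) k‖ ^ 2

omit [DecidableEq d] in
/-- The lattice weights are at least `1`. [folklore] -/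
theorem one_le_latWeight (k : d → ℤ) (m : ℕ) : (1 : ℝ) ≤ (1 + freqNormSq k) ^ m :=
  one_le_pow₀ (by linarith [freqNormSq_nonneg k])

omit [DecidableEq d] in
/-- The lattice weights are positive. [folklore] -/
theorem latWeight_pos (k : d → ℤ) (m : ℕ) : (0 : ℝ) < (1 + freqNormSq k) ^ m :=
  lt_of_lt_of_le one_pos (one_le_latWeight k m)

/-- **Summability of the weighted series** for a smooth field. [folklore] -/
theorem summable_latWeight (hu : IsSmooth u) (m : ℕ) :
    Summable fun k : d → ℤ => (1 + freqNormSq k) ^ m * ‖mFourierCoeff (EuclideanSpace.complexify ∘ u) k‖ ^ 2 := by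
  have hpg : SymL2.PolyGrowth (fun k : d → ℤ => sobolevWeight (m : ℝ) k) :=
    ⟨1, m, fun k => by
      have hk : (1 : ℝ) ≤ 1 + freqNormSq k := by linarith [freqNormSq_nonneg k]
      rw [abs_of_pos (sobolevWeight_pos _ _), one_mul, sobolevWeight, ← Real.rpow_natCast _ m]
      exact Real.rpow_le_rpow_of_exponent_le hk (by have : (0 : ℝ) ≤ m := Nat.cast_nonneg m; linarith)⟩
  have hws := SymL2.hasSum_norm_sq_ofSmooth (SymL2.IsWeight.mk (fun k => sobolevWeight_pos (m : ℝ) k)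
    (fun k => by rw [sobolevWeight, sobolevWeight, freqNormSq_neg])) hpg hu
  have hw2 : ∀ k : d → ℤ, sobolevWeight (m : ℝ) k ^ 2 = (1 + freqNormSq k) ^ m := fun k => by
    have hk : (0 : ℝ) ≤ 1 + freqNormSq k := by linarith [freqNormSq_nonneg k]
    rw [sobolevWeight, ← Real.rpow_natCast _ 2, ← Real.rpow_mul hk, show (m : ℝ) / 2 * (2 : ℕ) = m by push_cast; ring,
      Real.rpow_natCast]
  simp only [hw2] at hws
  exact hws.summable

omit [DecidableEq d] in
/-- The lattice energy is nonnegative. [folklore] -/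
theorem latNormSq_nonneg (m : ℕ) (u : UnitAddTorus d → EuclideanSpace ℝ d) : 0 ≤ latNormSq m u :=
  tsum_nonneg fun k => mul_nonneg (latWeight_pos k m).le (sq_nonneg _)

/-- **Monotonicity in the level.** [folklore] -/
theorem latNormSq_mono (hu : IsSmooth u) {m m' : ℕ} (h : m ≤ m') : latNormSq m u ≤ latNormSq m' u := by
  refine (summable_latWeight hu m).tsum_le_tsum (fun k => ?_) (summable_latWeight hu m')
  refine mul_le_mul_of_nonneg_right ?_ (sq_nonneg _)
  exact pow_le_pow_right₀ (by linarith [freqNormSq_nonneg k]) h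

omit [DecidableEq d] in
/-- **Level zero is the `L²` norm** (Plancherel). [cite: Grafakos2014, Prop. 3.2.7 (1)] -/
theorem latNormSq_zero (hu : IsSmooth u) : latNormSq 0 u = ∫ x, ‖u x‖ ^ 2 := by
  simp only [latNormSq, pow_zero, one_mul]
  exact (hasSum_norm_sq_mFourierCoeff hu).tsum_eq

/-- **`L²` norms of word derivatives by the lattice energy**: `∫ ‖∂_w u‖² ≤ (4π²)^m latNormSq m u`
for `|w| ≤ m`. [folklore] -/
theorem integral_norm_sq_wordDeriv_le_latNormSq (hu : IsSmooth u) {w : List d} {m : ℕ} (hw : w.length ≤ m) :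
    ∫ x, ‖wordDeriv w u x‖ ^ 2 ≤ (4 * Real.pi ^ 2) ^ m * latNormSq m u :=
  integral_norm_sq_wordDeriv_le hu hw

/-- The `L²` norm by the lattice energy: `∫ ‖u‖² ≤ latNormSq m u`. [folklore] -/
theorem integral_norm_sq_le_latNormSq (hu : IsSmooth u) (m : ℕ) : ∫ x, ‖u x‖ ^ 2 ≤ latNormSq m u := by
  rw [← latNormSq_zero hu]
  exact latNormSq_mono hu (Nat.zero_le m)

/-- **The lattice energy by the pure word derivatives**:
`latNormSq m u ≤ (#d + 1)^m (∫ ‖u‖² + ∑ᵢ ∫ ‖∂ᵢᵐ u‖²)`. [folklore] -/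
theorem latNormSq_le_pure (hu : IsSmooth u) (m : ℕ) :
    latNormSq m u ≤ ((Fintype.card d : ℝ) + 1) ^ m *
      ((∫ x, ‖u x‖ ^ 2) + ∑ i, ∫ x, ‖wordDeriv (List.replicate m i) u x‖ ^ 2) :=
  tsum_weight_mul_norm_sq_le hu m

/-! ### Derivatives shift the level -/

/-- **`latNormSq m (∂_w u) ≤ (4π²)^{|w|} latNormSq (m + |w|) u`.** [folklore] -/
theorem latNormSq_wordDeriv_le (hu : IsSmooth u) (m : ℕ) (w : List d) :
    latNormSq m (wordDeriv w u) ≤ (4 * Real.pi ^ 2) ^ w.length * latNormSq (m + w.length) u := by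
  unfold latNormSq
  rw [← tsum_mul_left]
  refine Summable.tsum_le_tsum (fun k => ?_) ?_ ((summable_latWeight hu _).mul_left _)
  · rw [mFourierCoeff_complexify_wordDeriv hu k w, norm_smul, mul_pow, pow_add]
    have h1 := norm_sq_wordSymbol_le_of_length_le k (le_refl w.length)
    have h0 : 0 ≤ ‖mFourierCoeff (EuclideanSpace.complexify ∘ u) k‖ ^ 2 := sq_nonneg _
    have hW : 0 ≤ (1 + freqNormSq k) ^ m := (latWeight_pos k m).le
    calc (1 + freqNormSq k) ^ m * (‖wordSymbol w k‖ ^ 2 * ‖mFourierCoeff (EuclideanSpace.complexify ∘ u) k‖ ^ 2)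
        ≤ (1 + freqNormSq k) ^ m * (((4 * Real.pi ^ 2) ^ w.length * (1 + freqNormSq k) ^ w.length) *
            ‖mFourierCoeff (EuclideanSpace.complexify ∘ u) k‖ ^ 2) :=
          mul_le_mul_of_nonneg_left (mul_le_mul_of_nonneg_right h1 h0) hW
      _ = _ := by ring
  · have := summable_latWeight (isSmooth_wordDeriv hu w) m
    exact this

/-- In particular `latNormSq m (∂ᵢ u) ≤ 4π² latNormSq (m + 1) u`. [folklore] -/
theorem latNormSq_partialDeriv_le (hu : IsSmooth u) (m : ℕ) (i : d) :
    latNormSq m (Torus.partialDeriv i u) ≤ 4 * Real.pi ^ 2 * latNormSq (m + 1) u := by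
  have := latNormSq_wordDeriv_le hu m [i]
  simpa using this

/-! ### Log-convexity in the level -/

/-- **Interpolation between levels** (Hölder on the lattice): for `0 < θ < 1` and levels with
`b = θ a + (1 - θ) c` (as real numbers), `latNormSq b u ≤ (latNormSq a u)^θ (latNormSq c u)^{1-θ}`.
[folklore] -/
theorem latNormSq_interpolate (hu : IsSmooth u) {a b c : ℕ} {θ : ℝ} (hθ0 : 0 < θ) (hθ1 : θ < 1)
    (habc : (b : ℝ) = θ * a + (1 - θ) * c) :
    latNormSq b u ≤ latNormSq a u ^ θ * latNormSq c u ^ (1 - θ) := by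
  set A : (d → ℤ) → ℝ := fun k => ‖mFourierCoeff (EuclideanSpace.complexify ∘ u) k‖ ^ 2 with hA
  have hA0 : ∀ k, 0 ≤ A k := fun k => sq_nonneg _
  have h1θ : 0 < 1 - θ := by linarith
  -- Hölder with exponents `1/θ`, `1/(1-θ)`
  have hpq : (1 / θ).HolderConjugate (1 / (1 - θ)) := Real.holderConjugate_one_div hθ0 h1θ (by ring)
  set f : (d → ℤ) → ℝ := fun k => ((1 + freqNormSq k) ^ a * A k) ^ θ with hf
  set g : (d → ℤ) → ℝ := fun k => ((1 + freqNormSq k) ^ c * A k) ^ (1 - θ) with hg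
  have hf0 : ∀ k, 0 ≤ f k := fun k => Real.rpow_nonneg (mul_nonneg (latWeight_pos k a).le (hA0 k)) _
  have hg0 : ∀ k, 0 ≤ g k := fun k => Real.rpow_nonneg (mul_nonneg (latWeight_pos k c).le (hA0 k)) _
  have hfp : ∀ k, f k ^ (1 / θ) = (1 + freqNormSq k) ^ a * A k := fun k => by
    rw [hf]; dsimp only
    rw [← Real.rpow_mul (mul_nonneg (latWeight_pos k a).le (hA0 k)), mul_one_div_cancel hθ0.ne', Real.rpow_one]
  have hgq : ∀ k, g k ^ (1 / (1 - θ)) = (1 + freqNormSq k) ^ c * A k := fun k => by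
    rw [hg]; dsimp only
    rw [← Real.rpow_mul (mul_nonneg (latWeight_pos k c).le (hA0 k)), mul_one_div_cancel h1θ.ne', Real.rpow_one]
  have hfs : Summable fun k => f k ^ (1 / θ) := by simp only [hfp]; exact summable_latWeight hu a
  have hgs : Summable fun k => g k ^ (1 / (1 - θ)) := by simp only [hgq]; exact summable_latWeight hu c
  have hH := Real.inner_le_Lp_mul_Lq_tsum_of_nonneg hpq hf0 hg0 hfs hgs
  simp only [hfp, hgq, one_div_one_div] at hH
  -- the product `f g` is the level-`b` term
  have hfg : ∀ k, f k * g k = (1 + freqNormSq k) ^ b * A k := fun k => by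
    rw [hf, hg]; dsimp only
    have hw : (0 : ℝ) ≤ 1 + freqNormSq k := by linarith [freqNormSq_nonneg k]
    rw [Real.mul_rpow (latWeight_pos k a).le (hA0 k), Real.mul_rpow (latWeight_pos k c).le (hA0 k)]
    have hAA : A k ^ θ * A k ^ (1 - θ) = A k := by
      rw [← Real.rpow_add' (hA0 k) (by linarith), add_sub_cancel, Real.rpow_one]
    have hWW : ((1 + freqNormSq k) ^ a) ^ θ * ((1 + freqNormSq k) ^ c) ^ (1 - θ) = (1 + freqNormSq k) ^ b := by
      have hpos : (0 : ℝ) < 1 + freqNormSq k := by linarith [freqNormSq_nonneg k]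
      rw [← Real.rpow_natCast _ a, ← Real.rpow_natCast _ c, ← Real.rpow_mul hw, ← Real.rpow_mul hw,
        ← Real.rpow_add hpos, ← Real.rpow_natCast _ b, habc]
      ring_nf
    calc ((1 + freqNormSq k) ^ a) ^ θ * A k ^ θ * (((1 + freqNormSq k) ^ c) ^ (1 - θ) * A k ^ (1 - θ))
        = (((1 + freqNormSq k) ^ a) ^ θ * ((1 + freqNormSq k) ^ c) ^ (1 - θ)) * (A k ^ θ * A k ^ (1 - θ)) := by ring
      _ = _ := by rw [hAA, hWW]
  simp only [hfg] at hH
  exact hH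

end Def

/-! ### Sobolev embeddings on `T³` in lattice form -/

section Embeddings

variable {u : UnitAddTorus d → EuclideanSpace ℝ d}

/-- **`H² ⊂ L^∞` on `T³` in lattice form**: `‖u(x)‖² ≤ K · latNormSq 2 u` for smooth real fields
(`card d = 3`). [folklore] -/
theorem exists_norm_sq_le_latNormSq_two (hd : Fintype.card d = 3) :
    ∃ K : ℝ, 0 ≤ K ∧ ∀ u : UnitAddTorus d → EuclideanSpace ℝ d, IsSmooth u → ∀ x,
      ‖u x‖ ^ 2 ≤ K * latNormSq 2 u := by
  obtain ⟨K, hK0, hK⟩ := norm_sq_le_sobolev_two_of_isSmooth (F' := EuclideanSpace ℝ d) hd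
  -- each of the three integrals is `≤ (4π²)² latNormSq 2 u`
  refine ⟨K * ((1 + Fintype.card d + Fintype.card d * Fintype.card d) * (4 * Real.pi ^ 2) ^ 2),
    by positivity, fun u hu x => ?_⟩
  have h := hK u hu x
  have hπ : (1 : ℝ) ≤ (4 * Real.pi ^ 2) ^ 2 := one_le_pow₀ (by nlinarith [Real.pi_gt_three])
  have hL0 : 0 ≤ latNormSq 2 u := latNormSq_nonneg 2 u
  have h0 : ∫ y, ‖u y‖ ^ 2 ≤ (4 * Real.pi ^ 2) ^ 2 * latNormSq 2 u :=
    (integral_norm_sq_le_latNormSq hu 2).trans (le_mul_of_one_le_left hL0 hπ)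
  have h1 : ∀ i, ∫ y, ‖Torus.partialDeriv i u y‖ ^ 2 ≤ (4 * Real.pi ^ 2) ^ 2 * latNormSq 2 u := fun i => by
    have := integral_norm_sq_wordDeriv_le_latNormSq hu (w := [i]) (m := 2) (by simp)
    simpa using this
  have h2 : ∀ i j, ∫ y, ‖Torus.partialDeriv i (Torus.partialDeriv j u) y‖ ^ 2 ≤ (4 * Real.pi ^ 2) ^ 2 * latNormSq 2 u :=
    fun i j => by
    have := integral_norm_sq_wordDeriv_le_latNormSq hu (w := [i, j]) (m := 2) (by simp)
    simpa using this
  calc ‖u x‖ ^ 2 ≤ K * ((∫ y, ‖u y‖ ^ 2) + (∑ i, ∫ y, ‖Torus.partialDeriv i u y‖ ^ 2) +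
        ∑ i, ∑ j, ∫ y, ‖Torus.partialDeriv i (Torus.partialDeriv j u) y‖ ^ 2) := h
    _ ≤ K * ((4 * Real.pi ^ 2) ^ 2 * latNormSq 2 u + (∑ _i : d, (4 * Real.pi ^ 2) ^ 2 * latNormSq 2 u) +
        ∑ _i : d, ∑ _j : d, (4 * Real.pi ^ 2) ^ 2 * latNormSq 2 u) := by
        gcongr with i _ i _ j _
        · exact h1 i
        · exact h2 i j
    _ = _ := by
        simp only [sum_const, card_univ, nsmul_eq_mul]
        ring

/-- **`H¹ ⊂ L⁴` on `T³` in lattice form**: `∫ ‖u‖⁴ ≤ K · (latNormSq 1 u)²` for smooth real fields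
(`card d = 3`). [folklore] -/
theorem exists_integral_norm_pow_four_le_latNormSq_one_sq (hd : Fintype.card d = 3) :
    ∃ K : ℝ, 0 ≤ K ∧ ∀ u : UnitAddTorus d → EuclideanSpace ℝ d, IsSmooth u →
      ∫ x, ‖u x‖ ^ 4 ≤ K * latNormSq 1 u ^ 2 := by
  obtain ⟨K, hK⟩ := lintegral_enorm_pow_four_le_sq_of_isSmooth (F' := EuclideanSpace ℝ d) (d := d)
    (by omega) (by omega)
  set c : ℝ := (1 + Fintype.card d * Fintype.card d) * (4 * Real.pi ^ 2) with hc
  refine ⟨K * c ^ 2, by positivity, fun u hu => ?_⟩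
  have hu1 : IsContDiff 1 u := hu.isContDiff (by simp)
  -- the real quantities
  have hL0 : 0 ≤ latNormSq 1 u := latNormSq_nonneg 1 u
  have hπ : (1 : ℝ) ≤ 4 * Real.pi ^ 2 := by nlinarith [Real.pi_gt_three]
  have hI0 : ∫ y, ‖u y‖ ^ 2 ≤ 4 * Real.pi ^ 2 * latNormSq 1 u :=
    (integral_norm_sq_le_latNormSq hu 1).trans (le_mul_of_one_le_left hL0 hπ)
  have hIi : ∀ i, ∫ y, ‖Torus.partialDeriv i u y‖ ^ 2 ≤ 4 * Real.pi ^ 2 * latNormSq 1 u := fun i => by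
    have := integral_norm_sq_wordDeriv_le_latNormSq hu (w := [i]) (m := 1) (by simp)
    simpa using this
  -- `∫ ‖Du‖² ≤ #d ∑ᵢ ∫ ‖∂ᵢu‖²`
  have hD : ∫ y, ‖Torus.fderiv u y‖ ^ 2 ≤ Fintype.card d * ∑ i, ∫ y, ‖Torus.partialDeriv i u y‖ ^ 2 := by
    have hint : ∀ i, Integrable (fun y => ‖Torus.partialDeriv i u y‖ ^ 2) volume := fun i =>
      ((hu.partialDeriv i).memLp 2).norm.integrable_sq
    calc ∫ y, ‖Torus.fderiv u y‖ ^ 2 ≤ ∫ y, Fintype.card d * ∑ i, ‖Torus.partialDeriv i u y‖ ^ 2 := by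
          refine integral_mono_of_nonneg (ae_of_all _ fun y => sq_nonneg _)
            ((integrable_finsetSum _ fun i _ => hint i).const_mul _) (ae_of_all _ fun y => ?_)
          exact norm_fderiv_sq_le_card_mul_sum hu1 y
      _ = _ := by rw [integral_const_mul, integral_finsetSum _ fun i _ => hint i]
  -- pass to `ℝ≥0∞` and back
  have hfin : ∀ {g : UnitAddTorus d → ℝ}, (∀ y, 0 ≤ g y) → Integrable g volume →
      ENNReal.ofReal (∫ y, g y) = ∫⁻ y, ENNReal.ofReal (g y) := fun hg hi =>
    ofReal_integral_eq_lintegral_ofReal hi (ae_of_all _ hg)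
  have hi4 : Integrable (fun y => ‖u y‖ ^ 4) volume := by
    have := (hu.memLp 4).norm
    have h4 : MemLp (fun y => ‖u y‖) (ENNReal.ofReal 4) volume := by
      rwa [show ENNReal.ofReal 4 = (4 : ℝ≥0∞) by norm_num]
    have := h4.integrable_norm_rpow (by norm_num) (by norm_num)
    simp only [Real.norm_eq_abs, abs_norm, ENNReal.toReal_ofReal (by norm_num : (0:ℝ) ≤ 4)] at this
    exact this.congr (ae_of_all _ fun y => by simp)
  have hi2 : Integrable (fun y => ‖u y‖ ^ 2) volume := (hu.memLp 2).norm.integrable_sq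
  have hsmD : IsSmooth (Torus.fderiv u) := by
    have hl : lift (Torus.fderiv u) = _root_.fderiv ℝ (lift u) := funext fun y => (fderiv_lift u y).symm
    show ContDiff ℝ ((⊤ : ℕ∞) : WithTop ℕ∞) (lift (Torus.fderiv u))
    rw [hl]
    exact hu.fderiv_right (m := ((⊤ : ℕ∞) : WithTop ℕ∞)) (by exact_mod_cast le_top)
  have hiD : Integrable (fun y => ‖Torus.fderiv u y‖ ^ 2) volume := (hsmD.memLp 2).norm.integrable_sq
  have key := hK u hu
  -- convert `key` to real numbers
  have e4 : ∫⁻ y, ‖u y‖ₑ ^ 4 = ENNReal.ofReal (∫ y, ‖u y‖ ^ 4) := by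
    rw [hfin (fun y => by positivity) hi4]
    refine lintegral_congr fun y => ?_
    rw [← ofReal_norm, ENNReal.ofReal_pow (norm_nonneg _)]
  have e2 : ∫⁻ y, ‖u y‖ₑ ^ 2 = ENNReal.ofReal (∫ y, ‖u y‖ ^ 2) := by
    rw [hfin (fun y => by positivity) hi2]
    refine lintegral_congr fun y => ?_
    rw [← ofReal_norm, ENNReal.ofReal_pow (norm_nonneg _)]
  have eD : ∫⁻ y, ‖Torus.fderiv u y‖ₑ ^ 2 = ENNReal.ofReal (∫ y, ‖Torus.fderiv u y‖ ^ 2) := by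
    rw [hfin (fun y => by positivity) hiD]
    refine lintegral_congr fun y => ?_
    rw [← ofReal_norm, ENNReal.ofReal_pow (norm_nonneg _)]
  have hI20 : 0 ≤ ∫ y, ‖u y‖ ^ 2 := integral_nonneg fun _ => sq_nonneg _
  have hID0 : 0 ≤ ∫ y, ‖Torus.fderiv u y‖ ^ 2 := integral_nonneg fun _ => sq_nonneg _
  rw [e4, e2, eD, ← ENNReal.ofReal_add hI20 hID0, ← ENNReal.ofReal_pow (by positivity),
    show (K : ℝ≥0∞) = ENNReal.ofReal (K : ℝ) by simp, ← ENNReal.ofReal_mul (NNReal.coe_nonneg K)] at key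
  have key' := (ENNReal.ofReal_le_ofReal_iff (by positivity)).1 key
  -- bound the bracket by `c · latNormSq 1 u`
  have hbr : (∫ y, ‖u y‖ ^ 2) + ∫ y, ‖Torus.fderiv u y‖ ^ 2 ≤ c * latNormSq 1 u := by
    calc (∫ y, ‖u y‖ ^ 2) + ∫ y, ‖Torus.fderiv u y‖ ^ 2
        ≤ 4 * Real.pi ^ 2 * latNormSq 1 u + Fintype.card d * ∑ _i : d, 4 * Real.pi ^ 2 * latNormSq 1 u :=
          add_le_add hI0 (hD.trans (mul_le_mul_of_nonneg_left (sum_le_sum fun i _ => hIi i) (Nat.cast_nonneg _)))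
      _ = c * latNormSq 1 u := by
          simp only [sum_const, card_univ, nsmul_eq_mul, hc]; ring
  calc ∫ y, ‖u y‖ ^ 4 ≤ K * ((∫ y, ‖u y‖ ^ 2) + ∫ y, ‖Torus.fderiv u y‖ ^ 2) ^ 2 := key'
    _ ≤ K * (c * latNormSq 1 u) ^ 2 :=
        mul_le_mul_of_nonneg_left (pow_le_pow_left₀ (by positivity) hbr 2) (NNReal.coe_nonneg K)
    _ = K * c ^ 2 * latNormSq 1 u ^ 2 := by ring

end Embeddings

end Torus

end Literature.Analysis.FluidPDE
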